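import Literature.MathematicalPhysics.QuantumLattice.DWaveSourceCapClassTPrimeTransport
import Literature.MathematicalPhysics.QuantumLattice.InfVolFermionStateMixture
import Literature.MathematicalPhysics.QuantumLattice.InfVolFermionStateGaugeAction
import HarnessLib

/-!
# Cap-CLASS transport in the FILLING (density) direction for the `d`-wave pair-sourced `t–t'` Hubbard model:
# a priced class sentence «every translation-invariant density-`n₀` state `σ` has `f σ ≤ M + κ·(E^{src}_{anchor}(σ) − u₀)`»
# is again a priced class sentence at every other density `n`, by MIXING the target state with a partner of known
# density, energy and pair amplitude — the Fock vacuum above `n₀`, a gauge-symmetric low-energy state below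

Topic `Literature/MathematicalPhysics/QuantumLattice` (namespace = path; family `hubbard`). Companion of
`DWaveSourceCapClassTPrimeTransport.lean` (this seat: the `t'`- and upward-`U` transport of the pinning-menu node shape) and of
`DWaveOrderParameterUCells.lean` (hubbard-downfold-unc-1: the `U` direction); written from the `t'`-box / covering lane of the
fast cell (`pub/hubbard-fast`, seat hubbard-box-p3) to give the ORDER word of a material cell its THIRD axis — the filling
interval `n ∈ [n₁, n₂]` of the box — from ONE menu solved at ONE density `n₀`, with no interval-filling menu (none exists).

THE POINT. The node shape of the pinning menus (`cert_pin2_A0menu_…_priced_…`, hubbard-obs-pin-1) is the Lagrangian reading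
of a dual certificate: for ALL translation-invariant `σ` of density `n₀`, `f σ ≤ M + κ·(e_Ψ(σ) − u₀)` (`κ ≥ 0` the cap row's
multiplier, `Ψ` the sourced anchor interaction, `f σ = √2·Re σ(P₀^d)`). The translation-invariant states form a CONVEX set on
which the density, the mean energy of every interaction and `f` are AFFINE (Bratteli–Robinson I §4.3.1; the tree's
`InfVolFermionState.mix`, `density_mix`, `meanEnergy_mix`, `mix_expect`). Hence (§3) if `ρ` is a translation-invariant PARTNER of
density `m` with `e_Ψ(ρ) ≤ c` and `f ρ ≥ −p`, and `n₀` lies between `m` and the target density `n`, then mixing a density-`n`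
state `σ` with `ρ` at the weight `λ = (n₀ − m)/(n − m)` lands in the node's class, and dividing the node's inequality by `λ`
gives the TRANSPORTED priced sentence at density `n`:

  `f σ ≤ (M + r·(M + κ(c − u₀) + p)) + κ·(e_Ψ(σ) − u₀)`,   `r = (n − n₀)/(n₀ − m) ≥ 0`

— same multiplier `κ`, same `u₀`, constant raised by `r·(node value at the partner's energy + p)`. Two partners are free of
charge in the tree: (§1–§2) the FOCK VACUUM (`m = 0`; translation invariant, GAUGE INVARIANT — so every pair amplitude
vanishes, `p = 0` — and of ZERO mean energy for every `t–t'` Hubbard / number / pair-source interaction term, since every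
such term annihilates `|∅⟩` on one side: `⟨∅|Φ(X)|∅⟩ = 0`), which serves every `n > n₀` at the price
`((n − n₀)/n₀)·(M − κu₀)`; and (§4) for `n < n₀` a GAUGE-SYMMETRIC translation-invariant state of any density `m ∈ (n₀, 2)`
whose sourced energy is below a certified CANONICAL cap `c ≥ e(1,t'₀,U₀;m)` (a torus limit of sector ground states of the
source-free model, as in `exists_isTranslationInvariant_density_meanEnergy_sourced_le`; pair amplitude `0`), at the price
`((n₀ − n)/(m − n₀))·(M + κ(c − u₀))`. §5 composes with the `(t', U)` transport of the companion file: from ONE priced node at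
`(t'₀, U₀, n₀)` every density-`n` sourced minimiser at every `(t', U)` obeys
`f ω ≤ M' + κ·(R + (16/π²)|t'₀ − t'| + max(U₀ − U, 0)·n/2 − u₀)` with `M'` the filling-transported constant — the
`(t', U, n)` CELL of response / order ceilings from one menu; §6 records the pair-amplitude slot verbatim.

HONEST SCOPE: bookkeeping of convexity; every cap, node and multiplier is a hypothesis to be discharged BY NAME by a certified
row. Ceilings only; nothing here floors order; no phase sentence. Everything is PROVED; no definition, no named fact, zero
compute, no `sorry`. The vacuum facts of §1 are folklore (Bratteli–Robinson II §5.2.1: the Fock state is quasi-free, gauge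
invariant, of zero particle number).

## References
* O. Bratteli, D. W. Robinson, *Operator Algebras and Quantum Statistical Mechanics 1*, 2nd ed. (1987), §4.3.1 (the
  invariant states form a convex set; affine functionals). [cite: BratteliRobinsonI1987, §4.3.1]
* O. Bratteli, D. W. Robinson, *Operator Algebras and Quantum Statistical Mechanics 2*, 2nd ed. (1997), §5.2.1–§5.2.2 (the
  Fock state; gauge-invariant states of the CAR algebra). [cite: BratteliRobinsonII1997, §5.2.2]
* J. Wang et al., Phys. Rev. X 14 (2024) 031006, §III (Lagrangian form of a relaxation certificate). [cite: WangEtAl2024, §III]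
* D. Ruelle, *Statistical Mechanics* (1969), §3.4 (thermodynamic-limit energy density by density classes). [cite: Ruelle1969, §3.4]
-/

noncomputable section

namespace Literature.MathematicalPhysics.QuantumLattice

open _root_.Matrix Finset Set HubbardWave0 Literature.Probability.LatticeModels ThermodynamicLimit _root_.Filter
open scoped _root_.Topology ComplexOrder

/-! ### §1 The Fock vacuum: zero `∅∅` entries of every Hubbard term, zero mean energy, gauge invariance -/

section VacuumEntries

variable {ι : Type*} [LinearOrder ι]

/-- `c_i` has zero `∅`-column: `⟨s| c_i |∅⟩ = 0` (no configuration is reached from the vacuum by removing a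
particle). [cite: BratteliRobinsonII1997, §5.2.1] -/
theorem annihilation_apply_empty_right (i : ι) (s : Finset ι) : annihilation i s ∅ = 0 := by
  rw [annihilation_apply, if_neg]
  rintro ⟨-, h⟩
  exact Finset.insert_ne_empty i s h.symm

variable [Fintype ι]

/-- A product ending in an annihilation operator has zero `∅`-column: `(A c_i) s ∅ = 0`.
[cite: BratteliRobinsonII1997, §5.2.1] -/
theorem mul_annihilation_apply_empty (A : Matrix (Finset ι) (Finset ι) ℂ) (i : ι) (s : Finset ι) :
    (A * annihilation i) s ∅ = 0 := by
  rw [Matrix.mul_apply]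
  exact Finset.sum_eq_zero fun u _ => by rw [annihilation_apply_empty_right, mul_zero]

end VacuumEntries

section VacuumTerms

variable {d : ℕ}

/-- Entries of a conditional matrix (the `Matrix` type is a definition, so `ite_apply` does not fire syntactically). [folklore] -/
private theorem matrix_ite_apply {m n α : Type*} (P : Prop) [Decidable P] (A B : Matrix m n α) (i : m) (j : n) :
    (if P then A else B) i j = if P then A i j else B i j := by
  split_ifs <;> rfl

/-- `(A c_{xσ}) s ∅ = 0` in a local algebra `𝔄_X`. [cite: BratteliRobinsonII1997, §5.2.1] -/
theorem mul_cAt_apply_empty {X : Finset (Site d)} (A : FermionOp X) (x : Site d) (hx : x ∈ X) (σ : Fin 2)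
    (s : Finset (Orb (PolySite X))) : (A * cAt x hx σ) s ∅ = 0 :=
  mul_annihilation_apply_empty A _ s

/-- `(A n_{xσ}) s ∅ = 0` (`n = c† c` ends in an annihilator). [cite: BratteliRobinsonII1997, §5.2.1] -/
theorem mul_nAt_apply_empty {X : Finset (Site d)} (A : FermionOp X) (x : Site d) (hx : x ∈ X) (σ : Fin 2)
    (s : Finset (Orb (PolySite X))) : (A * nAt x hx σ) s ∅ = 0 := by
  rw [show nAt x hx σ = creation (orb (PolySite.pt x hx) σ) * annihilation (orb (PolySite.pt x hx) σ) from rfl,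
    ← Matrix.mul_assoc]
  exact mul_annihilation_apply_empty _ _ s

/-- The hopping term `c†_{xσ} c_{yτ}` has zero vacuum entry. [cite: BratteliRobinsonII1997, §5.2.1] -/
theorem cAt_conjTranspose_mul_cAt_apply_empty_empty {X : Finset (Site d)} (x y : Site d) (hx : x ∈ X) (hy : y ∈ X)
    (σ τ : Fin 2) : ((cAt x hx σ)ᴴ * cAt y hy τ) ∅ ∅ = 0 :=
  mul_cAt_apply_empty _ y hy τ ∅

/-- The on-site repulsion `n_{x↑} n_{x↓}` has zero vacuum entry. [cite: BratteliRobinsonII1997, §5.2.1] -/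
theorem nAt_mul_nAt_apply_empty_empty {X : Finset (Site d)} (x : Site d) (hx : x ∈ X) (σ τ : Fin 2) :
    (nAt x hx σ * nAt x hx τ) ∅ ∅ = 0 :=
  mul_nAt_apply_empty _ x hx τ ∅

/-- The singlet pair annihilator `b_{x,y}` has zero `∅`-column. [cite: BratteliRobinsonII1997, §5.2.1] -/
theorem singletPairAt_apply_empty {X : Finset (Site d)} (x y : Site d) (hx : x ∈ X) (hy : y ∈ X)
    (s : Finset (Orb (PolySite X))) : singletPairAt x y hx hy s ∅ = 0 := by
  show (cAt x hx 0 * cAt y hy 1 - cAt x hx 1 * cAt y hy 0) s ∅ = 0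
  rw [Matrix.sub_apply, mul_cAt_apply_empty, mul_cAt_apply_empty, sub_zero]

/-- The pair-source term `b + b†` has zero vacuum entry. [cite: BratteliRobinsonII1997, §5.2.1] -/
theorem singletPairAt_add_conjTranspose_apply_empty_empty {X : Finset (Site d)} (x y : Site d) (hx : x ∈ X)
    (hy : y ∈ X) : (singletPairAt x y hx hy + (singletPairAt x y hx hy)ᴴ) ∅ ∅ = 0 := by
  rw [Matrix.add_apply, Matrix.conjTranspose_apply, singletPairAt_apply_empty, star_zero, add_zero]

/-- **Every term of the nearest-neighbour Hubbard interaction has zero vacuum entry**: `⟨∅|Φ^{t,U}(X)|∅⟩ = 0`.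
[cite: BratteliRobinsonII1997, §5.2.1] -/
theorem hubbardFermionInteraction_apply_empty_empty (t U : ℝ) (X : Finset (Site d)) :
    (hubbardFermionInteraction d t U).Φ X ∅ ∅ = 0 := by
  have hn : ∀ (x : Site d) (hx : x ∈ X), (nAt x hx 0 * nAt x hx 1) ∅ ∅ = 0 := fun x hx =>
    nAt_mul_nAt_apply_empty_empty x hx 0 1
  have hc : ∀ (x y : Site d) (hx : x ∈ X) (hy : y ∈ X) (σ : Fin 2),
      ((cAt x hx σ)ᴴ * cAt y hy σ + (cAt y hy σ)ᴴ * cAt x hx σ) ∅ ∅ = 0 := by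
    intro x y hx hy σ
    rw [Matrix.add_apply, cAt_conjTranspose_mul_cAt_apply_empty_empty, cAt_conjTranspose_mul_cAt_apply_empty_empty,
      add_zero]
  simp only [hubbardFermionInteraction, Matrix.add_apply, Matrix.sum_apply, matrix_ite_apply, Matrix.zero_apply,
    Matrix.smul_apply, hn, hc, smul_zero, ite_self, Finset.sum_const_zero, add_zero]

/-- **Every term of the diagonal hopping interaction has zero vacuum entry.** [cite: BratteliRobinsonII1997, §5.2.1] -/
theorem diagHoppingFermionInteraction_apply_empty_empty (t' : ℝ) (X : Finset (Site 2)) :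
    (diagHoppingFermionInteraction t').Φ X ∅ ∅ = 0 := by
  have hc : ∀ (x y : Site 2) (hx : x ∈ X) (hy : y ∈ X) (σ : Fin 2),
      ((cAt x hx σ)ᴴ * cAt y hy σ + (cAt y hy σ)ᴴ * cAt x hx σ) ∅ ∅ = 0 := by
    intro x y hx hy σ
    rw [Matrix.add_apply, cAt_conjTranspose_mul_cAt_apply_empty_empty, cAt_conjTranspose_mul_cAt_apply_empty_empty,
      add_zero]
  simp only [diagHoppingFermionInteraction, Matrix.sum_apply, matrix_ite_apply, Matrix.zero_apply, Matrix.smul_apply, hc,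
    smul_zero, ite_self, Finset.sum_const_zero]

/-- **Every term of the `t–t'` Hubbard interaction has zero vacuum entry.** [cite: BratteliRobinsonII1997, §5.2.1] -/
theorem hubbardTTPrimeFermionInteraction_apply_empty_empty (t t' U : ℝ) (X : Finset (Site 2)) :
    (hubbardTTPrimeFermionInteraction t t' U).Φ X ∅ ∅ = 0 := by
  rw [hubbardTTPrimeFermionInteraction_apply, Matrix.add_apply, hubbardFermionInteraction_apply_empty_empty,
    diagHoppingFermionInteraction_apply_empty_empty, add_zero]

/-- **Every term of the number interaction has zero vacuum entry.** [cite: BratteliRobinsonII1997, §5.2.1] -/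
theorem numberInteraction_apply_empty_empty (X : Finset (Site d)) : (numberInteraction d).Φ X ∅ ∅ = 0 := by
  have hn : ∀ (x : Site d) (hx : x ∈ X), (nAt x hx 0 + nAt x hx 1) ∅ ∅ = 0 := by
    intro x hx
    have h0 := mul_nAt_apply_empty (1 : FermionOp X) x hx 0 ∅
    have h1 := mul_nAt_apply_empty (1 : FermionOp X) x hx 1 ∅
    rw [Matrix.one_mul] at h0 h1
    rw [Matrix.add_apply, h0, h1, add_zero]
  simp only [numberInteraction, Matrix.sum_apply, matrix_ite_apply, Matrix.zero_apply, hn, ite_self, Finset.sum_const_zero]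

/-- **Every term of the pair-source interaction has zero vacuum entry** (any form factor `g`).
[cite: BratteliRobinsonII1997, §5.2.1] -/
theorem pairSourceInteraction_apply_empty_empty (g : Site 2 → ℝ) (X : Finset (Site 2)) :
    (pairSourceInteraction g).Φ X ∅ ∅ = 0 := by
  have hp : ∀ (x y : Site 2) (hx : x ∈ X) (hy : y ∈ X),
      (singletPairAt x y hx hy + (singletPairAt x y hx hy)ᴴ) ∅ ∅ = 0 := fun x y hx hy =>
    singletPairAt_add_conjTranspose_apply_empty_empty x y hx hy
  simp only [pairSourceInteraction, Matrix.add_apply, Matrix.sum_apply, matrix_ite_apply, Matrix.zero_apply,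
    Matrix.smul_apply, hp, smul_zero, ite_self, Finset.sum_const_zero, add_zero]

/-- **Every term of the grand-canonical `t–t'` pencil `Φ(t,t',U) − μ n` has zero vacuum entry.**
[cite: BratteliRobinsonII1997, §5.2.1] -/
theorem hubbardTTPrimeMuInteraction_apply_empty_empty (t t' U μ : ℝ) (X : Finset (Site 2)) :
    (hubbardTTPrimeMuInteraction t t' U μ).Φ X ∅ ∅ = 0 := by
  rw [hubbardTTPrimeMuInteraction_apply, Matrix.add_apply, Matrix.smul_apply, hubbardTTPrimeFermionInteraction_apply_empty_empty,
    numberInteraction_apply_empty_empty, smul_zero, add_zero]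

/-- **Every term of the pair-SOURCED `t–t'` Hubbard interaction has zero vacuum entry** (any `t, t', U, μ, g, h`).
[cite: BratteliRobinsonII1997, §5.2.1] -/
theorem hubbardTTPrimeSourcedInteraction_apply_empty_empty (t t' U μ : ℝ) (g : Site 2 → ℝ) (h : ℝ) (X : Finset (Site 2)) :
    (hubbardTTPrimeSourcedInteraction t t' U μ g h).Φ X ∅ ∅ = 0 := by
  rw [hubbardTTPrimeSourcedInteraction_apply, Matrix.add_apply, Matrix.smul_apply, hubbardTTPrimeMuInteraction_apply_empty_empty,
    pairSourceInteraction_apply_empty_empty, smul_zero, add_zero]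

/-- **The vacuum mean energy of an interaction whose terms have zero vacuum entry is `0`**: `e_Ψ(ω_∅) = Re Σ_X |X|⁻¹ ⟨∅|Φ(X)|∅⟩`.
[cite: BratteliKishimotoRobinson1978, §3 (mean energy functional)] -/
theorem FermionInteraction.meanEnergy_vacuumState_of_apply_empty_empty (Ψ : FermionInteraction d) (R : ℝ)
    (h : ∀ X : Finset (Site d), Ψ.Φ X ∅ ∅ = 0) : (vacuumState d).meanEnergy Ψ R = 0 := by
  rw [InfVolFermionState.meanEnergy, InfVolFermionState.vacuumState_expect, FermionInteraction.meanEnergyObs, Matrix.sum_apply,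
    Finset.sum_eq_zero, Complex.zero_re]
  intro X _
  rw [Matrix.smul_apply, fermionEmbed_apply_empty_empty, h, smul_zero]

end VacuumTerms

namespace InfVolFermionState

variable {d : ℕ}

/-- The vacuum has density `0`. [cite: BratteliRobinsonII1997, §5.2.1] -/
theorem density_vacuumState : (vacuumState d).density = 0 :=
  densityAt_vacuumState 0

/-- **The Fock vacuum is gauge invariant** (`γ_θ` multiplies the matrix unit `|s⟩⟨t|` by `e^{iθ(|s|−|t|)}`, trivial at
`s = t = ∅`). [cite: BratteliRobinsonII1997, §5.2.2] -/
theorem vacuumState_isGaugeInvariant : (vacuumState d).IsGaugeInvariant := fun θ =>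
  InfVolFermionState.ext fun Λ => LinearMap.ext fun A => by
    rw [gaugeShift_expect, vacuumState_expect, vacuumState_expect, gaugeAut_apply_apply]
    simp

/-- The vacuum has zero pair amplitude: `ω_∅(P_x) = 0`. [cite: BratteliRobinsonII1997, §5.2.2] -/
theorem vacuumState_expect_localPairAt (S : Finset (Site 2)) (g : Site 2 → ℝ) (x : Site 2) :
    (vacuumState 2).expect (pairRegion S x) (localPairAt S g x) = 0 :=
  vacuumState_isGaugeInvariant.expect_localPairAt_eq_zero S g x

/-- **The vacuum has zero `t–t'` Hubbard energy** (every `t, t', U`). [cite: BratteliRobinsonII1997, §5.2.1] -/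
theorem meanEnergy_hubbardTTPrime_vacuumState (t t' U : ℝ) :
    (vacuumState 2).meanEnergy (hubbardTTPrimeFermionInteraction t t' U) 1 = 0 :=
  FermionInteraction.meanEnergy_vacuumState_of_apply_empty_empty _ 1 (hubbardTTPrimeFermionInteraction_apply_empty_empty t t' U)

/-- **The vacuum has zero SOURCED energy** (every `t, t', U, μ`, form factor `g`, field `h`): the partner of zero density, zero
energy and zero pair amplitude. [cite: BratteliRobinsonII1997, §5.2.1] -/
theorem meanEnergy_hubbardTTPrimeSourced_vacuumState (t t' U μ : ℝ) (g : Site 2 → ℝ) (h : ℝ) :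
    (vacuumState 2).meanEnergy (hubbardTTPrimeSourcedInteraction t t' U μ g h) 1 = 0 :=
  FermionInteraction.meanEnergy_vacuumState_of_apply_empty_empty _ 1 (hubbardTTPrimeSourcedInteraction_apply_empty_empty t t' U μ g h)

/-! ### §2 The pair-amplitude slot is affine under mixtures -/

/-- **`√2·Re ω(P_x)` is affine on the state space**: for the mixture `t ω₁ + (1 − t) ω₂`,
`√2·Re (mix)(P_x) = t·√2·Re ω₁(P_x) + (1 − t)·√2·Re ω₂(P_x)`. [cite: BratteliRobinsonI1987, §4.3.1] -/
theorem sqrtTwo_mul_re_expect_localPairAt_mix (t : ℝ) (ht₀ : 0 ≤ t) (ht₁ : t ≤ 1) (ω₁ ω₂ : InfVolFermionState 2)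
    (S : Finset (Site 2)) (g : Site 2 → ℝ) (x : Site 2) :
    Real.sqrt 2 * ((mix t ht₀ ht₁ ω₁ ω₂).expect (pairRegion S x) (localPairAt S g x)).re =
      t * (Real.sqrt 2 * (ω₁.expect (pairRegion S x) (localPairAt S g x)).re) +
        (1 - t) * (Real.sqrt 2 * (ω₂.expect (pairRegion S x) (localPairAt S g x)).re) := by
  rw [mix_expect, Complex.add_re, Complex.re_ofReal_mul, Complex.re_ofReal_mul]
  ring

/-- The real part of any local expectation is affine under mixtures. [cite: BratteliRobinsonI1987, §4.3.1] -/
theorem re_expect_mix (t : ℝ) (ht₀ : 0 ≤ t) (ht₁ : t ≤ 1) (ω₁ ω₂ : InfVolFermionState d) (Λ : Finset (Site d))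
    (A : FermionOp Λ) :
    ((mix t ht₀ ht₁ ω₁ ω₂).expect Λ A).re = t * (ω₁.expect Λ A).re + (1 - t) * (ω₂.expect Λ A).re := by
  rw [mix_expect, Complex.add_re, Complex.re_ofReal_mul, Complex.re_ofReal_mul]

/-! ### §3 The abstract filling transport of a priced class sentence (any interaction, any affine `f`, any partner) -/

/-- **FILLING TRANSPORT OF A PRICED CLASS SENTENCE** (the state space is convex; density, mean energy and `f` are affine).
Node at density `n₀`: `f σ ≤ M + κ·(e_Ψ(σ) − u₀)` for every translation-invariant `σ` of density `n₀`, `κ ≥ 0`. Partner `ρ`: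
translation invariant, density `m`, `e_Ψ(ρ) ≤ c`, `−p ≤ f ρ`. If `n₀` lies between `m` and `n` (`m < n₀ ≤ n` or `n ≤ n₀ < m`),
then every translation-invariant `σ` of density `n` satisfies
`f σ ≤ (M + r·(M + κ(c − u₀) + p)) + κ·(e_Ψ(σ) − u₀)`, `r = (n − n₀)/(n₀ − m)` — mix `σ` and `ρ` with weight
`λ = (n₀ − m)/(n − m)` on `σ`, apply the node to the mixture, divide by `λ`. [cite: BratteliRobinsonI1987, §4.3.1] -/
theorem le_priced_of_capClass_filling_of_partner {f : InfVolFermionState d → ℝ} {Ψ : FermionInteraction d} {R : ℝ}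
    {n₀ n m M κ u₀ c p : ℝ} (hκ : 0 ≤ κ)
    (hf : ∀ (t : ℝ) (ht₀ : 0 ≤ t) (ht₁ : t ≤ 1) (ω₁ ω₂ : InfVolFermionState d),
      f (mix t ht₀ ht₁ ω₁ ω₂) = t * f ω₁ + (1 - t) * f ω₂)
    (hW : ∀ σ : InfVolFermionState d, σ.IsTranslationInvariant → σ.density = n₀ → f σ ≤ M + κ * (σ.meanEnergy Ψ R - u₀))
    {ρ : InfVolFermionState d} (hρ : ρ.IsTranslationInvariant) (hρm : ρ.density = m) (hρc : ρ.meanEnergy Ψ R ≤ c)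
    (hρp : -p ≤ f ρ) (hbetween : (m < n₀ ∧ n₀ ≤ n) ∨ (n ≤ n₀ ∧ n₀ < m))
    {σ : InfVolFermionState d} (hσ : σ.IsTranslationInvariant) (hσn : σ.density = n) :
    f σ ≤ (M + (n - n₀) / (n₀ - m) * (M + κ * (c - u₀) + p)) + κ * (σ.meanEnergy Ψ R - u₀) := by
  -- the weight `λ = (n₀ - m)/(n - m) ∈ (0, 1]`
  have hnm : n - m ≠ 0 := by rcases hbetween with ⟨h1, h2⟩ | ⟨h1, h2⟩ <;> [exact ne_of_gt (by linarith); exact ne_of_lt (by linarith)]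
  have hn₀m : n₀ - m ≠ 0 := by rcases hbetween with ⟨h1, h2⟩ | ⟨h1, h2⟩ <;> [exact ne_of_gt (by linarith); exact ne_of_lt (by linarith)]
  have hw0 : 0 < (n₀ - m) / (n - m) := by
    rcases hbetween with ⟨h1, h2⟩ | ⟨h1, h2⟩
    · exact div_pos (by linarith) (by linarith)
    · exact div_pos_of_neg_of_neg (by linarith) (by linarith)
  have hw1 : (n₀ - m) / (n - m) ≤ 1 := by
    rcases hbetween with ⟨h1, h2⟩ | ⟨h1, h2⟩
    · rw [div_le_one (by linarith)]; linarith
    · rw [div_le_one_of_neg (by linarith)]; linarith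
  set w : ℝ := (n₀ - m) / (n - m) with hw
  -- the mixture lies in the node's class
  have hTI := hσ.mix hρ w hw0.le hw1
  have hdens : (mix w hw0.le hw1 σ ρ).density = n₀ := by
    rw [density_mix, hσn, hρm, hw]
    field_simp
    ring
  have hnode := hW _ hTI hdens
  rw [hf, meanEnergy_mix] at hnode
  -- bound the partner's contributions
  have h1w : 0 ≤ 1 - w := sub_nonneg.2 hw1
  have hE : κ * ((1 - w) * ρ.meanEnergy Ψ R) ≤ κ * ((1 - w) * c) :=
    mul_le_mul_of_nonneg_left (mul_le_mul_of_nonneg_left hρc h1w) hκ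
  have hP : -((1 - w) * p) ≤ (1 - w) * f ρ := by
    rw [← mul_neg]; exact mul_le_mul_of_nonneg_left hρp h1w
  have key : w * f σ ≤ M + κ * (w * σ.meanEnergy Ψ R) + κ * ((1 - w) * c) - κ * u₀ + (1 - w) * p := by
    nlinarith [hnode, hE, hP]
  -- divide by `w`: `w · r = 1 - w`
  have hr : w * ((n - n₀) / (n₀ - m)) = 1 - w := by
    rw [hw]
    field_simp
    ring
  refine le_of_mul_le_mul_left ?_ hw0
  have hgoal : w * ((M + (n - n₀) / (n₀ - m) * (M + κ * (c - u₀) + p)) + κ * (σ.meanEnergy Ψ R - u₀)) =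
      M + κ * (w * σ.meanEnergy Ψ R) + κ * ((1 - w) * c) - κ * u₀ + (1 - w) * p := by
    linear_combination (M + κ * (c - u₀) + p) * hr
  rw [hgoal]
  exact key

/-! ### §4 The two partners: the vacuum (every `n > n₀`), a gauge-symmetric canonical state (every `n < n₀`) -/

section Sourced

/-- **UPWARD FILLING TRANSPORT WITH THE VACUUM** (sourced `t–t'` Hubbard anchor interaction, any `t'₀, U₀, μ, g, h`; any
affine `f` with `f(vacuum) ≥ −p`): a priced class sentence at density `n₀ > 0` gives, at every density `n ≥ n₀`,
`f σ ≤ (M + ((n − n₀)/n₀)·(M − κu₀ + p)) + κ·(E^{src}(σ) − u₀)`. [cite: BratteliRobinsonI1987, §4.3.1] -/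
theorem le_priced_of_capClass_filling_up_vacuum {f : InfVolFermionState 2 → ℝ} {t t'₀ U₀ μ h n₀ n M κ u₀ p : ℝ}
    {g : Site 2 → ℝ} (hκ : 0 ≤ κ)
    (hf : ∀ (s : ℝ) (hs₀ : 0 ≤ s) (hs₁ : s ≤ 1) (ω₁ ω₂ : InfVolFermionState 2),
      f (mix s hs₀ hs₁ ω₁ ω₂) = s * f ω₁ + (1 - s) * f ω₂)
    (hW : ∀ σ : InfVolFermionState 2, σ.IsTranslationInvariant → σ.density = n₀ →
      f σ ≤ M + κ * (σ.meanEnergy (hubbardTTPrimeSourcedInteraction t t'₀ U₀ μ g h) 1 - u₀))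
    (hvac : -p ≤ f (vacuumState 2)) (hn₀ : 0 < n₀) (hle : n₀ ≤ n)
    {σ : InfVolFermionState 2} (hσ : σ.IsTranslationInvariant) (hσn : σ.density = n) :
    f σ ≤ (M + (n - n₀) / n₀ * (M - κ * u₀ + p)) +
      κ * (σ.meanEnergy (hubbardTTPrimeSourcedInteraction t t'₀ U₀ μ g h) 1 - u₀) := by
  have key := le_priced_of_capClass_filling_of_partner (m := 0) (c := 0) hκ hf hW vacuumState_isTranslationInvariant
    density_vacuumState (meanEnergy_hubbardTTPrimeSourced_vacuumState t t'₀ U₀ μ g h).le hvac (Or.inl ⟨hn₀, hle⟩) hσ hσn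
  simpa only [sub_zero, zero_sub, mul_neg, ← sub_eq_add_neg] using key

/-- **A GAUGE-SYMMETRIC LOW-ENERGY PARTNER FROM A CANONICAL CAP** (refines
`exists_isTranslationInvariant_density_meanEnergy_sourced_le`, keeping the symmetry): if `e(1,t',U;m) ≤ c` (`U ≥ 0`,
`0 ≤ m < 2`) then for every field `h` some translation-invariant, GAUGE-INVARIANT state of density `m` has sourced energy
`E^{src}_{t',U,h} ≤ c` (chemical-potential slot `0`) — and zero pair amplitude. [cite: BratteliRobinsonII1997, §5.2.2] -/
theorem exists_isTranslationInvariant_isGaugeInvariant_density_meanEnergy_sourced_le (t' : ℝ) {U : ℝ} (hU : 0 ≤ U)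
    {m : ℝ} (hm0 : 0 ≤ m) (hm2 : m < 2) (h : ℝ) {c : ℝ} (hc : energyDensityTT' 1 t' U m ≤ c) :
    ∃ ρ : InfVolFermionState 2, ρ.IsTranslationInvariant ∧ ρ.IsGaugeInvariant ∧ ρ.density = m ∧
      ρ.meanEnergy (hubbardTTPrimeSourcedInteraction 1 t' U 0 dWaveFormFactor h) 1 ≤ c := by
  -- adapted from `exists_isTranslationInvariant_density_meanEnergy_sourced_le` (DWaveSourceCapClassTPrimeTransport §3)
  obtain ⟨ψ, φ, ω, -, hψ, -, hω, hTI, -, hdens, hE⟩ :=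
    exists_isTorusLimitOf_meanEnergy_hubbardTTPrime_eq 1 t' hU hm0 hm2 (Ls := id) tendsto_id
  have hG : ω.IsGaugeInvariant :=
    hω.isGaugeInvariant' (N := fun L => rectN m L) fun L => ((mem_szSector_iff _ _ _).1 (hψ L).1).1
  refine ⟨ω, hTI, hG, hdens, ?_⟩
  rw [InfVolFermionState.meanEnergy_hubbardTTPrimeSourced, InfVolFermionState.meanEnergy_pairSourceInteraction_dWave_eq,
    hG.expect_localPairAt_eq_zero, hE]
  simp only [Complex.zero_re, mul_zero, sub_zero, zero_mul]
  exact hc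

/-- **FILLING TRANSPORT OF THE PAIR-AMPLITUDE NODE WITH A CANONICAL PARTNER** (both directions): priced menu node at
`(t'₀, U₀, h)`, density `n₀` («`√2·Re σ(P₀^d) ≤ M̃ + κ·(E^{src}(σ) − u₀)`»), a canonical cap `e(1,t'₀,U₀;m) ≤ c` at a partner
density `m` (`0 ≤ m < 2`, `U₀ ≥ 0`) with `n₀` between `m` and `n` ⇒ every translation-invariant `σ` of density `n` has
`√2·Re σ(P₀^d) ≤ (M̃ + ((n − n₀)/(n₀ − m))·(M̃ + κ(c − u₀))) + κ·(E^{src}(σ) − u₀)` — the partner is gauge symmetric, so its pair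
amplitude is `0`. [cite: BratteliRobinsonI1987, §4.3.1] -/
theorem sqrtTwo_mul_pairAmp_le_priced_of_menuNode_filling_of_canonicalPartner {t'₀ U₀ h n₀ n m Mt κ u₀ c : ℝ}
    (hU₀ : 0 ≤ U₀) (hm0 : 0 ≤ m) (hm2 : m < 2) (hκ : 0 ≤ κ)
    (hM : ∀ σ : InfVolFermionState 2, σ.IsTranslationInvariant → σ.density = n₀ →
      Real.sqrt 2 * (σ.expect (pairRegion (insert 0 unitSteps) 0) (localPairAt (insert 0 unitSteps) dWaveFormFactor 0)).re ≤
        Mt + κ * (σ.meanEnergy (hubbardTTPrimeSourcedInteraction 1 t'₀ U₀ 0 dWaveFormFactor h) 1 - u₀))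
    (hc : energyDensityTT' 1 t'₀ U₀ m ≤ c) (hbetween : (m < n₀ ∧ n₀ ≤ n) ∨ (n ≤ n₀ ∧ n₀ < m))
    {σ : InfVolFermionState 2} (hσ : σ.IsTranslationInvariant) (hσn : σ.density = n) :
    Real.sqrt 2 * (σ.expect (pairRegion (insert 0 unitSteps) 0) (localPairAt (insert 0 unitSteps) dWaveFormFactor 0)).re ≤
      (Mt + (n - n₀) / (n₀ - m) * (Mt + κ * (c - u₀))) +
        κ * (σ.meanEnergy (hubbardTTPrimeSourcedInteraction 1 t'₀ U₀ 0 dWaveFormFactor h) 1 - u₀) := by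
  obtain ⟨ρ, hρ, hρG, hρm, hρc⟩ :=
    exists_isTranslationInvariant_isGaugeInvariant_density_meanEnergy_sourced_le t'₀ hU₀ hm0 hm2 h hc
  have hρp : -(0 : ℝ) ≤ Real.sqrt 2 * (ρ.expect (pairRegion (insert 0 unitSteps) 0)
      (localPairAt (insert 0 unitSteps) dWaveFormFactor 0)).re := by
    rw [hρG.expect_localPairAt_eq_zero, Complex.zero_re, mul_zero, neg_zero]
  have key := le_priced_of_capClass_filling_of_partner
    (f := fun σ => Real.sqrt 2 * (σ.expect (pairRegion (insert 0 unitSteps) 0)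
      (localPairAt (insert 0 unitSteps) dWaveFormFactor 0)).re) (p := 0) hκ
    (fun s hs₀ hs₁ ω₁ ω₂ => sqrtTwo_mul_re_expect_localPairAt_mix s hs₀ hs₁ ω₁ ω₂ _ _ _) hM hρ hρm hρc hρp hbetween hσ hσn
  simpa only [add_zero] using key

/-- **UPWARD FILLING TRANSPORT OF THE PAIR-AMPLITUDE NODE WITH THE VACUUM**: priced menu node at density `n₀ > 0` ⇒ at every
density `n ≥ n₀`, every translation-invariant `σ` of density `n` has
`√2·Re σ(P₀^d) ≤ (M̃ + ((n − n₀)/n₀)·(M̃ − κu₀)) + κ·(E^{src}(σ) − u₀)`. [cite: BratteliRobinsonI1987, §4.3.1] -/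
theorem sqrtTwo_mul_pairAmp_le_priced_of_menuNode_filling_up {t t'₀ U₀ μ h n₀ n Mt κ u₀ : ℝ} {g : Site 2 → ℝ} (hκ : 0 ≤ κ)
    (hM : ∀ σ : InfVolFermionState 2, σ.IsTranslationInvariant → σ.density = n₀ →
      Real.sqrt 2 * (σ.expect (pairRegion (insert 0 unitSteps) 0) (localPairAt (insert 0 unitSteps) dWaveFormFactor 0)).re ≤
        Mt + κ * (σ.meanEnergy (hubbardTTPrimeSourcedInteraction t t'₀ U₀ μ g h) 1 - u₀))
    (hn₀ : 0 < n₀) (hle : n₀ ≤ n)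
    {σ : InfVolFermionState 2} (hσ : σ.IsTranslationInvariant) (hσn : σ.density = n) :
    Real.sqrt 2 * (σ.expect (pairRegion (insert 0 unitSteps) 0) (localPairAt (insert 0 unitSteps) dWaveFormFactor 0)).re ≤
      (Mt + (n - n₀) / n₀ * (Mt - κ * u₀)) +
        κ * (σ.meanEnergy (hubbardTTPrimeSourcedInteraction t t'₀ U₀ μ g h) 1 - u₀) := by
  have hvac : -(0 : ℝ) ≤ Real.sqrt 2 * ((vacuumState 2).expect (pairRegion (insert 0 unitSteps) 0)
      (localPairAt (insert 0 unitSteps) dWaveFormFactor 0)).re := by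
    rw [vacuumState_expect_localPairAt, Complex.zero_re, mul_zero, neg_zero]
  have key := le_priced_of_capClass_filling_up_vacuum
    (f := fun σ => Real.sqrt 2 * (σ.expect (pairRegion (insert 0 unitSteps) 0)
      (localPairAt (insert 0 unitSteps) dWaveFormFactor 0)).re) (p := 0) hκ
    (fun s hs₀ hs₁ ω₁ ω₂ => sqrtTwo_mul_re_expect_localPairAt_mix s hs₀ hs₁ ω₁ ω₂ _ _ _) hM hvac hn₀ hle hσ hσn
  simpa only [add_zero] using key

/-! ### §5 The `(t', U, n)` CELL from ONE menu node: filling transport composed with the `(t', U)` transport -/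

/-- **PRICED CELL TRANSPORT, UPWARD IN THE FILLING (vacuum partner), THEN TO A `(t', U)` TARGET** (kinematic in both
couplings, `DWaveSourceCapClassTPrimeTransport` §4): a priced class sentence at `(t'₀, U₀, h)`, density `n₀ > 0`, for an affine
`f` with `f(vacuum) ≥ −p`; a target `(t', U)` (`U ≥ 0`), density `n ∈ [n₀, 2)` with canonical cap `e(1,t',U;n) ≤ R` ⇒ every
density-`n` sourced minimiser `ω` at `(t', U, h)` has
`f ω ≤ (M + ((n − n₀)/n₀)·(M − κu₀ + p)) + κ·(R + (16/π²)|t'₀ − t'| + max(U₀ − U, 0)·n/2 − u₀)`. [cite: WangEtAl2024, §III] -/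
theorem canonicalMinimiser_le_priced_of_capClass_filling_up_tPrime_U {f : InfVolFermionState 2 → ℝ}
    {t'₀ t' U₀ U h n₀ n u₀ R M κ p : ℝ} (hU : 0 ≤ U) (hn₀ : 0 < n₀) (hle : n₀ ≤ n) (hn2 : n < 2) (hκ : 0 ≤ κ)
    (hf : ∀ (s : ℝ) (hs₀ : 0 ≤ s) (hs₁ : s ≤ 1) (ω₁ ω₂ : InfVolFermionState 2),
      f (mix s hs₀ hs₁ ω₁ ω₂) = s * f ω₁ + (1 - s) * f ω₂)
    (hW : ∀ σ : InfVolFermionState 2, σ.IsTranslationInvariant → σ.density = n₀ →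
      f σ ≤ M + κ * (σ.meanEnergy (hubbardTTPrimeSourcedInteraction 1 t'₀ U₀ 0 dWaveFormFactor h) 1 - u₀))
    (hvac : -p ≤ f (vacuumState 2)) (hR : energyDensityTT' 1 t' U n ≤ R)
    {ω : InfVolFermionState 2} (hω : ω.IsTranslationInvariant) (hρ : ω.density = n)
    (hmin : ∀ ω' : InfVolFermionState 2, ω'.IsTranslationInvariant → ω'.density = n →
      ω.meanEnergy (hubbardTTPrimeSourcedInteraction 1 t' U 0 dWaveFormFactor h) 1 ≤
        ω'.meanEnergy (hubbardTTPrimeSourcedInteraction 1 t' U 0 dWaveFormFactor h) 1) :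
    f ω ≤ (M + (n - n₀) / n₀ * (M - κ * u₀ + p)) +
      κ * (R + 16 / Real.pi ^ 2 * |t'₀ - t'| + max (U₀ - U) 0 * (n / 2) - u₀) :=
  canonicalMinimiser_le_priced_of_capClass_tPrime_U (f := f) hU (hn₀.le.trans hle) hn2 hκ
    (fun _ hσ hσn => le_priced_of_capClass_filling_up_vacuum hκ hf hW hvac hn₀ hle hσ hσn) hR hω hρ hmin

/-- **PRICED CELL TRANSPORT WITH A PARTNER, THEN TO A `(t', U)` TARGET** (abstract partner `ρ`: translation invariant,
density `m`, anchor energy `≤ c`, `f ρ ≥ −p`; `n₀` between `m` and `n`): every density-`n` sourced minimiser `ω` at `(t', U, h)`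
(`U ≥ 0`, `0 ≤ n < 2`, `e(1,t',U;n) ≤ R`) has
`f ω ≤ (M + r·(M + κ(c − u₀) + p)) + κ·(R + (16/π²)|t'₀ − t'| + max(U₀ − U, 0)·n/2 − u₀)`, `r = (n − n₀)/(n₀ − m)`.
[cite: WangEtAl2024, §III] -/
theorem canonicalMinimiser_le_priced_of_capClass_filling_of_partner_tPrime_U {f : InfVolFermionState 2 → ℝ}
    {t'₀ t' U₀ U h n₀ n m u₀ R M κ c p : ℝ} (hU : 0 ≤ U) (hn0 : 0 ≤ n) (hn2 : n < 2) (hκ : 0 ≤ κ)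
    (hf : ∀ (s : ℝ) (hs₀ : 0 ≤ s) (hs₁ : s ≤ 1) (ω₁ ω₂ : InfVolFermionState 2),
      f (mix s hs₀ hs₁ ω₁ ω₂) = s * f ω₁ + (1 - s) * f ω₂)
    (hW : ∀ σ : InfVolFermionState 2, σ.IsTranslationInvariant → σ.density = n₀ →
      f σ ≤ M + κ * (σ.meanEnergy (hubbardTTPrimeSourcedInteraction 1 t'₀ U₀ 0 dWaveFormFactor h) 1 - u₀))
    {ρ : InfVolFermionState 2} (hρTI : ρ.IsTranslationInvariant) (hρm : ρ.density = m)
    (hρc : ρ.meanEnergy (hubbardTTPrimeSourcedInteraction 1 t'₀ U₀ 0 dWaveFormFactor h) 1 ≤ c) (hρp : -p ≤ f ρ)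
    (hbetween : (m < n₀ ∧ n₀ ≤ n) ∨ (n ≤ n₀ ∧ n₀ < m)) (hR : energyDensityTT' 1 t' U n ≤ R)
    {ω : InfVolFermionState 2} (hω : ω.IsTranslationInvariant) (hρ : ω.density = n)
    (hmin : ∀ ω' : InfVolFermionState 2, ω'.IsTranslationInvariant → ω'.density = n →
      ω.meanEnergy (hubbardTTPrimeSourcedInteraction 1 t' U 0 dWaveFormFactor h) 1 ≤
        ω'.meanEnergy (hubbardTTPrimeSourcedInteraction 1 t' U 0 dWaveFormFactor h) 1) :
    f ω ≤ (M + (n - n₀) / (n₀ - m) * (M + κ * (c - u₀) + p)) +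
      κ * (R + 16 / Real.pi ^ 2 * |t'₀ - t'| + max (U₀ - U) 0 * (n / 2) - u₀) :=
  canonicalMinimiser_le_priced_of_capClass_tPrime_U (f := f) hU hn0 hn2 hκ
    (fun _ hσ hσn => le_priced_of_capClass_filling_of_partner hκ hf hW hρTI hρm hρc hρp hbetween hσ hσn) hR hω hρ hmin

/-! ### §6 The pair-amplitude slot of the pinning menus on the `(t', U, n)` cell -/

/-- **`(t', U, n)`-CELL PAIR-AMPLITUDE CEILING FROM ONE PRICED MENU NODE, UPWARD IN THE FILLING** (vacuum partner): node at
`(t'₀, U₀, h)`, density `n₀ > 0`; target `(t', U)` (`U ≥ 0`), density `n ∈ [n₀, 2)`, canonical cap `e(1,t',U;n) ≤ R` ⇒ every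
density-`n` sourced minimiser at `(t', U, h)` has
`√2·Re ω(P₀^d) ≤ (M̃ + ((n − n₀)/n₀)·(M̃ − κu₀)) + κ·(R + (16/π²)|t'₀ − t'| + max(U₀ − U, 0)·n/2 − u₀)`. At `h = 0` these are
the translation-invariant density-`n` GROUND STATES of the unsourced `t–t'` model. Ceiling only. [cite: WangEtAl2024, §III] -/
theorem canonicalMinimiser_sqrtTwo_mul_pairAmp_le_priced_of_menuNode_filling_up_tPrime_U
    {t'₀ t' U₀ U h n₀ n u₀ R Mt κ : ℝ} (hU : 0 ≤ U) (hn₀ : 0 < n₀) (hle : n₀ ≤ n) (hn2 : n < 2) (hκ : 0 ≤ κ)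
    (hM : ∀ σ : InfVolFermionState 2, σ.IsTranslationInvariant → σ.density = n₀ →
      Real.sqrt 2 * (σ.expect (pairRegion (insert 0 unitSteps) 0) (localPairAt (insert 0 unitSteps) dWaveFormFactor 0)).re ≤
        Mt + κ * (σ.meanEnergy (hubbardTTPrimeSourcedInteraction 1 t'₀ U₀ 0 dWaveFormFactor h) 1 - u₀))
    (hR : energyDensityTT' 1 t' U n ≤ R)
    {ω : InfVolFermionState 2} (hω : ω.IsTranslationInvariant) (hρ : ω.density = n)
    (hmin : ∀ ω' : InfVolFermionState 2, ω'.IsTranslationInvariant → ω'.density = n →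
      ω.meanEnergy (hubbardTTPrimeSourcedInteraction 1 t' U 0 dWaveFormFactor h) 1 ≤
        ω'.meanEnergy (hubbardTTPrimeSourcedInteraction 1 t' U 0 dWaveFormFactor h) 1) :
    Real.sqrt 2 * (ω.expect (pairRegion (insert 0 unitSteps) 0) (localPairAt (insert 0 unitSteps) dWaveFormFactor 0)).re ≤
      (Mt + (n - n₀) / n₀ * (Mt - κ * u₀)) +
        κ * (R + 16 / Real.pi ^ 2 * |t'₀ - t'| + max (U₀ - U) 0 * (n / 2) - u₀) :=
  canonicalMinimiser_le_priced_of_capClass_tPrime_U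
    (f := fun σ => Real.sqrt 2 * (σ.expect (pairRegion (insert 0 unitSteps) 0)
      (localPairAt (insert 0 unitSteps) dWaveFormFactor 0)).re) hU (hn₀.le.trans hle) hn2 hκ
    (fun _ hσ hσn => sqrtTwo_mul_pairAmp_le_priced_of_menuNode_filling_up hκ hM hn₀ hle hσ hσn) hR hω hρ hmin

/-- **`(t', U, n)`-CELL PAIR-AMPLITUDE CEILING FROM ONE PRICED MENU NODE AND ONE CANONICAL PARTNER CAP** (both filling
directions; the partner is a gauge-symmetric state of density `m` below the canonical cap `e(1,t'₀,U₀;m) ≤ c`, `n₀` between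
`m` and `n`): every density-`n` sourced minimiser at `(t', U, h)` (`U, U₀ ≥ 0`, `0 ≤ n < 2`, `e(1,t',U;n) ≤ R`) has
`√2·Re ω(P₀^d) ≤ (M̃ + ((n − n₀)/(n₀ − m))·(M̃ + κ(c − u₀))) + κ·(R + (16/π²)|t'₀ − t'| + max(U₀ − U, 0)·n/2 − u₀)`.
Ceiling only. [cite: WangEtAl2024, §III] -/
theorem canonicalMinimiser_sqrtTwo_mul_pairAmp_le_priced_of_menuNode_filling_of_canonicalPartner_tPrime_U
    {t'₀ t' U₀ U h n₀ n m u₀ R Mt κ c : ℝ} (hU : 0 ≤ U) (hU₀ : 0 ≤ U₀) (hn0 : 0 ≤ n) (hn2 : n < 2)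
    (hm0 : 0 ≤ m) (hm2 : m < 2) (hκ : 0 ≤ κ)
    (hM : ∀ σ : InfVolFermionState 2, σ.IsTranslationInvariant → σ.density = n₀ →
      Real.sqrt 2 * (σ.expect (pairRegion (insert 0 unitSteps) 0) (localPairAt (insert 0 unitSteps) dWaveFormFactor 0)).re ≤
        Mt + κ * (σ.meanEnergy (hubbardTTPrimeSourcedInteraction 1 t'₀ U₀ 0 dWaveFormFactor h) 1 - u₀))
    (hc : energyDensityTT' 1 t'₀ U₀ m ≤ c) (hbetween : (m < n₀ ∧ n₀ ≤ n) ∨ (n ≤ n₀ ∧ n₀ < m))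
    (hR : energyDensityTT' 1 t' U n ≤ R)
    {ω : InfVolFermionState 2} (hω : ω.IsTranslationInvariant) (hρ : ω.density = n)
    (hmin : ∀ ω' : InfVolFermionState 2, ω'.IsTranslationInvariant → ω'.density = n →
      ω.meanEnergy (hubbardTTPrimeSourcedInteraction 1 t' U 0 dWaveFormFactor h) 1 ≤
        ω'.meanEnergy (hubbardTTPrimeSourcedInteraction 1 t' U 0 dWaveFormFactor h) 1) :
    Real.sqrt 2 * (ω.expect (pairRegion (insert 0 unitSteps) 0) (localPairAt (insert 0 unitSteps) dWaveFormFactor 0)).re ≤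
      (Mt + (n - n₀) / (n₀ - m) * (Mt + κ * (c - u₀))) +
        κ * (R + 16 / Real.pi ^ 2 * |t'₀ - t'| + max (U₀ - U) 0 * (n / 2) - u₀) :=
  canonicalMinimiser_le_priced_of_capClass_tPrime_U
    (f := fun σ => Real.sqrt 2 * (σ.expect (pairRegion (insert 0 unitSteps) 0)
      (localPairAt (insert 0 unitSteps) dWaveFormFactor 0)).re) hU hn0 hn2 hκ
    (fun _ hσ hσn => sqrtTwo_mul_pairAmp_le_priced_of_menuNode_filling_of_canonicalPartner hU₀ hm0 hm2 hκ hM hc hbetween hσ hσn)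
    hR hω hρ hmin

/-- **AT THE ANCHOR'S OWN COUPLINGS** (`t' = t'₀`, `U = U₀ ≥ 0`; the pure filling extent of a node), upward with the vacuum:
every density-`n` sourced minimiser at `(t'₀, U₀, h)`, `n ∈ [n₀, 2)`, `e(1,t'₀,U₀;n) ≤ R`, has
`√2·Re ω(P₀^d) ≤ (M̃ + ((n − n₀)/n₀)·(M̃ − κu₀)) + κ·(R − u₀)`. [cite: WangEtAl2024, §III] -/
theorem canonicalMinimiser_sqrtTwo_mul_pairAmp_le_priced_of_menuNode_filling_up_anchor
    {t'₀ U₀ h n₀ n u₀ R Mt κ : ℝ} (hU₀ : 0 ≤ U₀) (hn₀ : 0 < n₀) (hle : n₀ ≤ n) (hn2 : n < 2) (hκ : 0 ≤ κ)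
    (hM : ∀ σ : InfVolFermionState 2, σ.IsTranslationInvariant → σ.density = n₀ →
      Real.sqrt 2 * (σ.expect (pairRegion (insert 0 unitSteps) 0) (localPairAt (insert 0 unitSteps) dWaveFormFactor 0)).re ≤
        Mt + κ * (σ.meanEnergy (hubbardTTPrimeSourcedInteraction 1 t'₀ U₀ 0 dWaveFormFactor h) 1 - u₀))
    (hR : energyDensityTT' 1 t'₀ U₀ n ≤ R)
    {ω : InfVolFermionState 2} (hω : ω.IsTranslationInvariant) (hρ : ω.density = n)
    (hmin : ∀ ω' : InfVolFermionState 2, ω'.IsTranslationInvariant → ω'.density = n →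
      ω.meanEnergy (hubbardTTPrimeSourcedInteraction 1 t'₀ U₀ 0 dWaveFormFactor h) 1 ≤
        ω'.meanEnergy (hubbardTTPrimeSourcedInteraction 1 t'₀ U₀ 0 dWaveFormFactor h) 1) :
    Real.sqrt 2 * (ω.expect (pairRegion (insert 0 unitSteps) 0) (localPairAt (insert 0 unitSteps) dWaveFormFactor 0)).re ≤
      (Mt + (n - n₀) / n₀ * (Mt - κ * u₀)) + κ * (R - u₀) := by
  have key := canonicalMinimiser_sqrtTwo_mul_pairAmp_le_priced_of_menuNode_filling_up_tPrime_U hU₀ hn₀ hle hn2 hκ hM hR hω hρ hmin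
  simpa only [sub_self, abs_zero, mul_zero, add_zero, max_self, zero_mul] using key

/-- **AT THE ANCHOR'S OWN COUPLINGS, with a canonical partner** (both filling directions): every density-`n` sourced minimiser at
`(t'₀, U₀, h)` (`U₀ ≥ 0`, `0 ≤ n < 2`, `e(1,t'₀,U₀;n) ≤ R`, partner cap `e(1,t'₀,U₀;m) ≤ c`, `n₀` between `m` and `n`) has
`√2·Re ω(P₀^d) ≤ (M̃ + ((n − n₀)/(n₀ − m))·(M̃ + κ(c − u₀))) + κ·(R − u₀)`. [cite: WangEtAl2024, §III] -/
theorem canonicalMinimiser_sqrtTwo_mul_pairAmp_le_priced_of_menuNode_filling_of_canonicalPartner_anchor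
    {t'₀ U₀ h n₀ n m u₀ R Mt κ c : ℝ} (hU₀ : 0 ≤ U₀) (hn0 : 0 ≤ n) (hn2 : n < 2) (hm0 : 0 ≤ m) (hm2 : m < 2) (hκ : 0 ≤ κ)
    (hM : ∀ σ : InfVolFermionState 2, σ.IsTranslationInvariant → σ.density = n₀ →
      Real.sqrt 2 * (σ.expect (pairRegion (insert 0 unitSteps) 0) (localPairAt (insert 0 unitSteps) dWaveFormFactor 0)).re ≤
        Mt + κ * (σ.meanEnergy (hubbardTTPrimeSourcedInteraction 1 t'₀ U₀ 0 dWaveFormFactor h) 1 - u₀))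
    (hc : energyDensityTT' 1 t'₀ U₀ m ≤ c) (hbetween : (m < n₀ ∧ n₀ ≤ n) ∨ (n ≤ n₀ ∧ n₀ < m))
    (hR : energyDensityTT' 1 t'₀ U₀ n ≤ R)
    {ω : InfVolFermionState 2} (hω : ω.IsTranslationInvariant) (hρ : ω.density = n)
    (hmin : ∀ ω' : InfVolFermionState 2, ω'.IsTranslationInvariant → ω'.density = n →
      ω.meanEnergy (hubbardTTPrimeSourcedInteraction 1 t'₀ U₀ 0 dWaveFormFactor h) 1 ≤
        ω'.meanEnergy (hubbardTTPrimeSourcedInteraction 1 t'₀ U₀ 0 dWaveFormFactor h) 1) :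
    Real.sqrt 2 * (ω.expect (pairRegion (insert 0 unitSteps) 0) (localPairAt (insert 0 unitSteps) dWaveFormFactor 0)).re ≤
      (Mt + (n - n₀) / (n₀ - m) * (Mt + κ * (c - u₀))) + κ * (R - u₀) := by
  have key := canonicalMinimiser_sqrtTwo_mul_pairAmp_le_priced_of_menuNode_filling_of_canonicalPartner_tPrime_U hU₀ hU₀ hn0
    hn2 hm0 hm2 hκ hM hc hbetween hR hω hρ hmin
  simpa only [sub_self, abs_zero, mul_zero, add_zero, max_self, zero_mul] using key

/-! ### §7 The FLOOR side: TRIAL states move along the filling axis too (density, sourced energy and every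
hopping word of a mixture with the vacuum scale by the weight) — the `n`-extent of the response-floor chords of
`DWaveSourceCapClassTPrimeTransport` §9 -/

/-- **A mixture with the vacuum scales every `t–t'` Hubbard mean energy** (any `t, t', U`; in particular the hopping words
`K₁ = e_{Φ(1,0,0)}`, `K₂ = e_{Φ(0,1,0)}` and `D = e_{Φ(0,0,1)}`): `e_Φ(s σ + (1−s) ω_∅) = s·e_Φ(σ)`. [cite: BratteliRobinsonI1987, §4.3.1] -/
theorem meanEnergy_hubbardTTPrime_mix_vacuumState (s : ℝ) (hs₀ : 0 ≤ s) (hs₁ : s ≤ 1) (σ : InfVolFermionState 2) (t t' U : ℝ) :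
    (mix s hs₀ hs₁ σ (vacuumState 2)).meanEnergy (hubbardTTPrimeFermionInteraction t t' U) 1 =
      s * σ.meanEnergy (hubbardTTPrimeFermionInteraction t t' U) 1 := by
  rw [meanEnergy_mix, meanEnergy_hubbardTTPrime_vacuumState, mul_zero, add_zero]

/-- **A mixture with the vacuum scales the SOURCED mean energy** (any `t, t', U, μ, g, h`). [cite: BratteliRobinsonI1987, §4.3.1] -/
theorem meanEnergy_hubbardTTPrimeSourced_mix_vacuumState (s : ℝ) (hs₀ : 0 ≤ s) (hs₁ : s ≤ 1) (σ : InfVolFermionState 2)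
    (t t' U μ : ℝ) (g : Site 2 → ℝ) (h : ℝ) :
    (mix s hs₀ hs₁ σ (vacuumState 2)).meanEnergy (hubbardTTPrimeSourcedInteraction t t' U μ g h) 1 =
      s * σ.meanEnergy (hubbardTTPrimeSourcedInteraction t t' U μ g h) 1 := by
  rw [meanEnergy_mix, meanEnergy_hubbardTTPrimeSourced_vacuumState, mul_zero, add_zero]

/-- **A mixture with the vacuum scales the density.** [cite: BratteliRobinsonI1987, §4.3.1] -/
theorem density_mix_vacuumState (s : ℝ) (hs₀ : 0 ≤ s) (hs₁ : s ≤ 1) (σ : InfVolFermionState d) :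
    (mix s hs₀ hs₁ σ (vacuumState d)).density = s * σ.density := by
  rw [density_mix, density_vacuumState, mul_zero, add_zero]

/-- **TRIAL STATES DOWN THE FILLING AXIS** (the cap rows of the response-floor chords): a translation-invariant trial state `σ` of
density `n₀ > 0` with anchor cap `E^{src}_{t'₀}(σ) ≤ u` and `K₂`-word `(t' − t'₀)·K₂(σ) ≤ c` yields, for every `n ∈ [0, n₀]`, a
translation-invariant trial state of density `n` with anchor cap `(n/n₀)·u` and `K₂`-word `(n/n₀)·c` — its mixture with the vacuum
(weight `n/n₀`). [cite: BratteliRobinsonI1987, §4.3.1] -/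
theorem exists_trial_filling_down_vacuum {σ : InfVolFermionState 2} (hσ : σ.IsTranslationInvariant) {n₀ n : ℝ}
    (hσρ : σ.density = n₀) (hn₀ : 0 < n₀) (hn0 : 0 ≤ n) (hle : n ≤ n₀) {t t'₀ t' U μ : ℝ} {g : Site 2 → ℝ} {h u c : ℝ}
    (hu : σ.meanEnergy (hubbardTTPrimeSourcedInteraction t t'₀ U μ g h) 1 ≤ u)
    (hc : (t' - t'₀) * σ.meanEnergy (hubbardTTPrimeFermionInteraction 0 1 0) 1 ≤ c) :
    ∃ τ : InfVolFermionState 2, τ.IsTranslationInvariant ∧ τ.density = n ∧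
      τ.meanEnergy (hubbardTTPrimeSourcedInteraction t t'₀ U μ g h) 1 ≤ n / n₀ * u ∧
      (t' - t'₀) * τ.meanEnergy (hubbardTTPrimeFermionInteraction 0 1 0) 1 ≤ n / n₀ * c := by
  have hw0 : 0 ≤ n / n₀ := div_nonneg hn0 hn₀.le
  have hw1 : n / n₀ ≤ 1 := by rw [div_le_one hn₀]; exact hle
  refine ⟨mix (n / n₀) hw0 hw1 σ (vacuumState 2), hσ.mix vacuumState_isTranslationInvariant _ hw0 hw1, ?_, ?_, ?_⟩
  · rw [density_mix_vacuumState, hσρ]; field_simp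
  · rw [meanEnergy_hubbardTTPrimeSourced_mix_vacuumState]; exact mul_le_mul_of_nonneg_left hu hw0
  · rw [meanEnergy_hubbardTTPrime_mix_vacuumState, mul_left_comm]; exact mul_le_mul_of_nonneg_left hc hw0

/-- **TRIAL STATES UP THE FILLING AXIS WITH A GAUGE-SYMMETRIC CANONICAL PARTNER**: a translation-invariant trial state `σ` of density
`n₀` with anchor cap `E^{src}_{t'₀,U₀,h}(σ) ≤ u` and `K₂`-word `(t' − t'₀)·K₂(σ) ≤ c`, plus a canonical cap `e(1,t'₀,U₀;m) ≤ c_m` at a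
partner density `m ∈ (n₀, 2)` (`U₀ ≥ 0`), yield for every `n ∈ [n₀, m]` a translation-invariant trial state of density `n` with anchor cap
`w·u + (1−w)·c_m` and `K₂`-word `w·c + (1−w)·(16/π²)|t' − t'₀|`, `w = (m − n)/(m − n₀)` (the partner's `K₂` is only known
kinematically). [cite: BratteliRobinsonI1987, §4.3.1] -/
theorem exists_trial_filling_up_of_canonicalPartner {σ : InfVolFermionState 2} (hσ : σ.IsTranslationInvariant) {n₀ n m : ℝ}
    (hσρ : σ.density = n₀) (hn₀n : n₀ ≤ n) (hnm : n ≤ m) (hn₀m : n₀ < m) (hm0 : 0 ≤ m) (hm2 : m < 2) {t'₀ t' U₀ : ℝ}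
    (hU₀ : 0 ≤ U₀) {h u c c_m : ℝ}
    (hu : σ.meanEnergy (hubbardTTPrimeSourcedInteraction 1 t'₀ U₀ 0 dWaveFormFactor h) 1 ≤ u)
    (hc : (t' - t'₀) * σ.meanEnergy (hubbardTTPrimeFermionInteraction 0 1 0) 1 ≤ c)
    (hcm : energyDensityTT' 1 t'₀ U₀ m ≤ c_m) :
    ∃ τ : InfVolFermionState 2, τ.IsTranslationInvariant ∧ τ.density = n ∧
      τ.meanEnergy (hubbardTTPrimeSourcedInteraction 1 t'₀ U₀ 0 dWaveFormFactor h) 1 ≤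
        (m - n) / (m - n₀) * u + (1 - (m - n) / (m - n₀)) * c_m ∧
      (t' - t'₀) * τ.meanEnergy (hubbardTTPrimeFermionInteraction 0 1 0) 1 ≤
        (m - n) / (m - n₀) * c + (1 - (m - n) / (m - n₀)) * (16 / Real.pi ^ 2 * |t' - t'₀|) := by
  obtain ⟨ρ, hρ, -, hρm, hρc⟩ :=
    exists_isTranslationInvariant_isGaugeInvariant_density_meanEnergy_sourced_le t'₀ hU₀ hm0 hm2 h hcm
  have hd : 0 < m - n₀ := sub_pos.2 hn₀m
  have hw0 : 0 ≤ (m - n) / (m - n₀) := div_nonneg (sub_nonneg.2 hnm) hd.le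
  have hw1 : (m - n) / (m - n₀) ≤ 1 := by rw [div_le_one hd]; linarith
  have h1w : 0 ≤ 1 - (m - n) / (m - n₀) := sub_nonneg.2 hw1
  refine ⟨mix _ hw0 hw1 σ ρ, hσ.mix hρ _ hw0 hw1, ?_, ?_, ?_⟩
  · rw [density_mix, hσρ, hρm]; field_simp; ring
  · rw [meanEnergy_mix]
    exact add_le_add (mul_le_mul_of_nonneg_left hu hw0) (mul_le_mul_of_nonneg_left hρc h1w)
  · rw [meanEnergy_mix, mul_add, mul_left_comm _ ((m - n) / (m - n₀)), mul_left_comm _ (1 - (m - n) / (m - n₀))]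
    exact add_le_add (mul_le_mul_of_nonneg_left hc hw0)
      (mul_le_mul_of_nonneg_left (hρ.mul_meanEnergy_diagHop_le_kinematic (t' - t'₀)) h1w)

/-- **RESPONSE FLOOR AT DENSITY `n ≤ n₀` FROM A DENSITY-`n₀` TRIAL STATE** (Griffiths' chord at the target `(t', U, n, h)`: canonical floor
`L ≤ e(1,t',U;n)` at the target, trial cap moved from the anchor `t'₀` along `t'` by its `K₂`-word and DOWN the filling axis by the vacuum):
`(L − (n/n₀)(u + c))/h ≤ e_P(ω) = 2·Re ω(P₀^d)` for every density-`n` sourced minimiser `ω` at `(t', U, h)` (`U ≥ 0`, `h > 0`, `0 < n ≤ n₀`,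
`n < 2`). [cite: Griffiths1966, §II] -/
theorem div_le_pairAmplitude_minimiser_of_canonicalFloor_of_trial_anchorCap_filling_down {t' t'₀ U n₀ n h u c L : ℝ}
    (hU : 0 ≤ U) (hn0 : 0 < n) (hle : n ≤ n₀) (hn2 : n < 2) (hh : 0 < h) (hL : L ≤ energyDensityTT' 1 t' U n)
    {σ : InfVolFermionState 2} (hσ : σ.IsTranslationInvariant) (hσρ : σ.density = n₀)
    (hu : σ.meanEnergy (hubbardTTPrimeSourcedInteraction 1 t'₀ U 0 dWaveFormFactor h) 1 ≤ u)
    (hc : (t' - t'₀) * σ.meanEnergy (hubbardTTPrimeFermionInteraction 0 1 0) 1 ≤ c)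
    {ω : InfVolFermionState 2} (hω : ω.IsTranslationInvariant) (hρ : ω.density = n)
    (hmin : ∀ ω' : InfVolFermionState 2, ω'.IsTranslationInvariant → ω'.density = n →
      ω.meanEnergy (hubbardTTPrimeSourcedInteraction 1 t' U 0 dWaveFormFactor h) 1 ≤
        ω'.meanEnergy (hubbardTTPrimeSourcedInteraction 1 t' U 0 dWaveFormFactor h) 1) :
    (L - n / n₀ * (u + c)) / h ≤ ω.meanEnergy (pairSourceInteraction dWaveFormFactor) 1 := by
  obtain ⟨τ, hτ, hτρ, hτu, hτc⟩ := exists_trial_filling_down_vacuum hσ hσρ (hn0.trans_le hle) hn0.le hle hu hc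
  have key := div_le_pairAmplitude_minimiser_of_canonicalFloor_of_trial_anchorCap hU hn0 hn2 hh hL hτ hτρ hτu hτc hω hρ hmin
  rwa [← mul_add] at key

/-- **RESPONSE FLOOR AT DENSITY `n ≥ n₀` FROM A DENSITY-`n₀` TRIAL STATE AND A CANONICAL PARTNER CAP** `e(1,t'₀,U;m) ≤ c_m` (`n₀ ≤ n ≤ m`,
`n₀ < m < 2`): `(L − (w(u + c) + (1−w)(c_m + (16/π²)|t' − t'₀|)))/h ≤ e_P(ω)`, `w = (m − n)/(m − n₀)`, for every density-`n` sourced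
minimiser `ω` at `(t', U, h)`. [cite: Griffiths1966, §II] -/
theorem div_le_pairAmplitude_minimiser_of_canonicalFloor_of_trial_anchorCap_filling_up {t' t'₀ U n₀ n m h u c c_m L : ℝ}
    (hU : 0 ≤ U) (hn0 : 0 < n) (hn₀n : n₀ ≤ n) (hnm : n ≤ m) (hn₀m : n₀ < m) (hm2 : m < 2) (hh : 0 < h)
    (hL : L ≤ energyDensityTT' 1 t' U n)
    {σ : InfVolFermionState 2} (hσ : σ.IsTranslationInvariant) (hσρ : σ.density = n₀)
    (hu : σ.meanEnergy (hubbardTTPrimeSourcedInteraction 1 t'₀ U 0 dWaveFormFactor h) 1 ≤ u)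
    (hc : (t' - t'₀) * σ.meanEnergy (hubbardTTPrimeFermionInteraction 0 1 0) 1 ≤ c)
    (hcm : energyDensityTT' 1 t'₀ U m ≤ c_m)
    {ω : InfVolFermionState 2} (hω : ω.IsTranslationInvariant) (hρ : ω.density = n)
    (hmin : ∀ ω' : InfVolFermionState 2, ω'.IsTranslationInvariant → ω'.density = n →
      ω.meanEnergy (hubbardTTPrimeSourcedInteraction 1 t' U 0 dWaveFormFactor h) 1 ≤
        ω'.meanEnergy (hubbardTTPrimeSourcedInteraction 1 t' U 0 dWaveFormFactor h) 1) :
    (L - ((m - n) / (m - n₀) * (u + c) + (1 - (m - n) / (m - n₀)) * (c_m + 16 / Real.pi ^ 2 * |t' - t'₀|))) / h ≤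
      ω.meanEnergy (pairSourceInteraction dWaveFormFactor) 1 := by
  have hn2 : n < 2 := lt_of_le_of_lt hnm hm2
  obtain ⟨τ, hτ, hτρ, hτu, hτc⟩ := exists_trial_filling_up_of_canonicalPartner hσ hσρ hn₀n hnm hn₀m (by linarith) hm2 hU hu hc hcm
  have key := div_le_pairAmplitude_minimiser_of_canonicalFloor_of_trial_anchorCap hU hn0 hn2 hh hL hτ hτρ hτu hτc hω hρ hmin
  have e : (m - n) / (m - n₀) * u + (1 - (m - n) / (m - n₀)) * c_m +
      ((m - n) / (m - n₀) * c + (1 - (m - n) / (m - n₀)) * (16 / Real.pi ^ 2 * |t' - t'₀|)) =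
      (m - n) / (m - n₀) * (u + c) + (1 - (m - n) / (m - n₀)) * (c_m + 16 / Real.pi ^ 2 * |t' - t'₀|) := by ring
  rwa [e] at key

/-! ### §8 Interval-filling PRICED classes from ONE point node (the `hW` of `DWaveSourceCapClassTPrimeTransport` §7) -/

/-- **A POINT NODE IS AN INTERVAL-FILLING NODE** (general affine `f`; vacuum above `n₀`, an explicit partner `ρ` of density `m > n₀` below):
if `M + ((n₂ − n₀)/n₀)·(M − κu₀ + p) ≤ M'` and `M + ((n₀ − n₁)/(m − n₀))·(M + κ(c − u₀) + q) ≤ M'` (both brackets `≥ 0`), then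
«`f σ ≤ M' + κ·(E^{src}(σ) − u₀)` for every translation-invariant `σ` with `σ.density ∈ [n₁, n₂]`» — the priced interval-filling
class sentence consumed by `canonicalMinimiser_le_priced_of_capClass_fillingInterval_tPrime_U`. [cite: BratteliRobinsonI1987, §4.3.1] -/
theorem le_priced_fillingInterval_of_pointNode {f : InfVolFermionState 2 → ℝ} {t t'₀ U₀ μ h : ℝ} {g : Site 2 → ℝ}
    {n₀ n₁ n₂ m M κ u₀ c p q M' : ℝ} (hκ : 0 ≤ κ)
    (hf : ∀ (s : ℝ) (hs₀ : 0 ≤ s) (hs₁ : s ≤ 1) (ω₁ ω₂ : InfVolFermionState 2),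
      f (mix s hs₀ hs₁ ω₁ ω₂) = s * f ω₁ + (1 - s) * f ω₂)
    (hW : ∀ σ : InfVolFermionState 2, σ.IsTranslationInvariant → σ.density = n₀ →
      f σ ≤ M + κ * (σ.meanEnergy (hubbardTTPrimeSourcedInteraction t t'₀ U₀ μ g h) 1 - u₀))
    (hvac : -p ≤ f (vacuumState 2))
    {ρ : InfVolFermionState 2} (hρ : ρ.IsTranslationInvariant) (hρm : ρ.density = m)
    (hρc : ρ.meanEnergy (hubbardTTPrimeSourcedInteraction t t'₀ U₀ μ g h) 1 ≤ c) (hρq : -q ≤ f ρ)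
    (hn₀ : 0 < n₀) (hm : n₀ < m)
    (hX : 0 ≤ M - κ * u₀ + p) (hY : 0 ≤ M + κ * (c - u₀) + q)
    (hup : M + (n₂ - n₀) / n₀ * (M - κ * u₀ + p) ≤ M') (hdn : M + (n₀ - n₁) / (m - n₀) * (M + κ * (c - u₀) + q) ≤ M')
    {σ : InfVolFermionState 2} (hσ : σ.IsTranslationInvariant) (hσn : σ.density ∈ Set.Icc n₁ n₂) :
    f σ ≤ M' + κ * (σ.meanEnergy (hubbardTTPrimeSourcedInteraction t t'₀ U₀ μ g h) 1 - u₀) := by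
  rcases le_total σ.density n₀ with hle | hge
  · have key := le_priced_of_capClass_filling_of_partner hκ hf hW hρ hρm hρc hρq (Or.inr ⟨hle, hm⟩) hσ rfl
    have hmn : 0 < m - n₀ := sub_pos.2 hm
    have hr : (σ.density - n₀) / (n₀ - m) ≤ (n₀ - n₁) / (m - n₀) := by
      rw [show (σ.density - n₀) / (n₀ - m) = (n₀ - σ.density) / (m - n₀) by
        rw [← neg_sub n₀ σ.density, ← neg_sub m n₀, neg_div_neg_eq]]
      exact div_le_div_of_nonneg_right (by linarith [hσn.1]) hmn.le
    have hrY := mul_le_mul_of_nonneg_right hr hY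
    linarith
  · have key := le_priced_of_capClass_filling_up_vacuum hκ hf hW hvac hn₀ hge hσ rfl
    have hr : (σ.density - n₀) / n₀ ≤ (n₂ - n₀) / n₀ := div_le_div_of_nonneg_right (by linarith [hσn.2]) hn₀.le
    have hrX := mul_le_mul_of_nonneg_right hr hX
    linarith

/-- **A MENU NODE IS AN INTERVAL-FILLING MENU NODE** (pair-amplitude slot; vacuum above `n₀`, a gauge-symmetric state below a canonical cap
`e(1,t'₀,U₀;m) ≤ c` at `m ∈ (n₀, 2)` below): with `M̃ + ((n₂ − n₀)/n₀)(M̃ − κu₀) ≤ M'` and `M̃ + ((n₀ − n₁)/(m − n₀))(M̃ + κ(c − u₀)) ≤ M'`,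
every translation-invariant `σ` with density in `[n₁, n₂]` has `√2·Re σ(P₀^d) ≤ M' + κ·(E^{src}_{t'₀,U₀,h}(σ) − u₀)`.
[cite: BratteliRobinsonI1987, §4.3.1] -/
theorem sqrtTwo_mul_pairAmp_le_priced_of_menuNode_fillingInterval {t'₀ U₀ h n₀ n₁ n₂ m Mt κ u₀ c M' : ℝ}
    (hU₀ : 0 ≤ U₀) (hm2 : m < 2) (hκ : 0 ≤ κ)
    (hM : ∀ σ : InfVolFermionState 2, σ.IsTranslationInvariant → σ.density = n₀ →
      Real.sqrt 2 * (σ.expect (pairRegion (insert 0 unitSteps) 0) (localPairAt (insert 0 unitSteps) dWaveFormFactor 0)).re ≤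
        Mt + κ * (σ.meanEnergy (hubbardTTPrimeSourcedInteraction 1 t'₀ U₀ 0 dWaveFormFactor h) 1 - u₀))
    (hc : energyDensityTT' 1 t'₀ U₀ m ≤ c)
    (hn₀ : 0 < n₀) (hm : n₀ < m)
    (hX : 0 ≤ Mt - κ * u₀) (hY : 0 ≤ Mt + κ * (c - u₀))
    (hup : Mt + (n₂ - n₀) / n₀ * (Mt - κ * u₀) ≤ M') (hdn : Mt + (n₀ - n₁) / (m - n₀) * (Mt + κ * (c - u₀)) ≤ M')
    {σ : InfVolFermionState 2} (hσ : σ.IsTranslationInvariant) (hσn : σ.density ∈ Set.Icc n₁ n₂) :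
    Real.sqrt 2 * (σ.expect (pairRegion (insert 0 unitSteps) 0) (localPairAt (insert 0 unitSteps) dWaveFormFactor 0)).re ≤
      M' + κ * (σ.meanEnergy (hubbardTTPrimeSourcedInteraction 1 t'₀ U₀ 0 dWaveFormFactor h) 1 - u₀) := by
  obtain ⟨ρ, hρ, hρG, hρm, hρc⟩ :=
    exists_isTranslationInvariant_isGaugeInvariant_density_meanEnergy_sourced_le t'₀ hU₀ (hn₀.le.trans hm.le) hm2 h hc
  have hρq : -(0 : ℝ) ≤ Real.sqrt 2 * (ρ.expect (pairRegion (insert 0 unitSteps) 0)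
      (localPairAt (insert 0 unitSteps) dWaveFormFactor 0)).re := by
    rw [hρG.expect_localPairAt_eq_zero, Complex.zero_re, mul_zero, neg_zero]
  have hvac : -(0 : ℝ) ≤ Real.sqrt 2 * ((vacuumState 2).expect (pairRegion (insert 0 unitSteps) 0)
      (localPairAt (insert 0 unitSteps) dWaveFormFactor 0)).re := by
    rw [vacuumState_expect_localPairAt, Complex.zero_re, mul_zero, neg_zero]
  exact le_priced_fillingInterval_of_pointNode
    (f := fun σ => Real.sqrt 2 * (σ.expect (pairRegion (insert 0 unitSteps) 0)
      (localPairAt (insert 0 unitSteps) dWaveFormFactor 0)).re) (p := 0) (q := 0) hκ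
    (fun s hs₀ hs₁ ω₁ ω₂ => sqrtTwo_mul_re_expect_localPairAt_mix s hs₀ hs₁ ω₁ ω₂ _ _ _) hM hvac hρ hρm hρc hρq hn₀ hm
    (by simpa using hX) (by simpa using hY) (by simpa using hup) (by simpa using hdn) hσ hσn

/-- **THE `(t', U, n)` CELL FROM ONE POINT NODE, uniform constant**: composing the interval-filling node above with
`canonicalMinimiser_le_priced_of_capClass_fillingInterval_tPrime_U`: every density-`n` sourced minimiser at `(t', U, h)` (`U ≥ 0`,
`n ∈ [n₁, n₂]`, `0 ≤ n₁`, `n₂ < 2`, canonical cap `e(1,t',U;n) ≤ R`) has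
`√2·Re ω(P₀^d) ≤ M' + κ·(R + (16/π²)|t'₀ − t'| + max(U₀ − U, 0)·n/2 − u₀)`. [cite: WangEtAl2024, §III] -/
theorem canonicalMinimiser_sqrtTwo_mul_pairAmp_le_priced_of_menuNode_fillingInterval_tPrime_U
    {t'₀ t' U₀ U h n₀ n₁ n₂ n m Mt κ u₀ c M' R : ℝ} (hU : 0 ≤ U) (hU₀ : 0 ≤ U₀) (hn₁ : 0 ≤ n₁) (hn₂ : n₂ < 2) (hm2 : m < 2)
    (hκ : 0 ≤ κ)
    (hM : ∀ σ : InfVolFermionState 2, σ.IsTranslationInvariant → σ.density = n₀ →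
      Real.sqrt 2 * (σ.expect (pairRegion (insert 0 unitSteps) 0) (localPairAt (insert 0 unitSteps) dWaveFormFactor 0)).re ≤
        Mt + κ * (σ.meanEnergy (hubbardTTPrimeSourcedInteraction 1 t'₀ U₀ 0 dWaveFormFactor h) 1 - u₀))
    (hc : energyDensityTT' 1 t'₀ U₀ m ≤ c)
    (hn₀ : 0 < n₀) (hm : n₀ < m)
    (hX : 0 ≤ Mt - κ * u₀) (hY : 0 ≤ Mt + κ * (c - u₀))
    (hup : Mt + (n₂ - n₀) / n₀ * (Mt - κ * u₀) ≤ M') (hdn : Mt + (n₀ - n₁) / (m - n₀) * (Mt + κ * (c - u₀)) ≤ M')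
    (hn : n ∈ Set.Icc n₁ n₂) (hR : energyDensityTT' 1 t' U n ≤ R)
    {ω : InfVolFermionState 2} (hω : ω.IsTranslationInvariant) (hρ : ω.density = n)
    (hmin : ∀ ω' : InfVolFermionState 2, ω'.IsTranslationInvariant → ω'.density = n →
      ω.meanEnergy (hubbardTTPrimeSourcedInteraction 1 t' U 0 dWaveFormFactor h) 1 ≤
        ω'.meanEnergy (hubbardTTPrimeSourcedInteraction 1 t' U 0 dWaveFormFactor h) 1) :
    Real.sqrt 2 * (ω.expect (pairRegion (insert 0 unitSteps) 0) (localPairAt (insert 0 unitSteps) dWaveFormFactor 0)).re ≤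
      M' + κ * (R + 16 / Real.pi ^ 2 * |t'₀ - t'| + max (U₀ - U) 0 * (n / 2) - u₀) :=
  canonicalMinimiser_le_priced_of_capClass_fillingInterval_tPrime_U
    (f := fun σ => Real.sqrt 2 * (σ.expect (pairRegion (insert 0 unitSteps) 0)
      (localPairAt (insert 0 unitSteps) dWaveFormFactor 0)).re) hU hn₁ hn₂ hn hκ
    (fun _ hσ hσn => sqrtTwo_mul_pairAmp_le_priced_of_menuNode_fillingInterval hU₀ hm2 hκ hM hc hn₀ hm hX hY hup hdn hσ hσn)
    hR hω hρ hmin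

end Sourced

end InfVolFermionState

end Literature.MathematicalPhysics.QuantumLattice

end
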